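import Summits.BirchSwinnertonDyer.BirchSwinnertonDyer.Theorems.PrintCf2RubinValueTwoKatzMeasureJZeroSeamValuesOfLabel
import Summits.BirchSwinnertonDyer.BirchSwinnertonDyer.Theorems.PrintCf2RubinValueTwoKatzMeasureJZeroClassLattices
import Summits.BirchSwinnertonDyer.BirchSwinnertonDyer.Theorems.PrintCf2RubinValueTwoKatzMeasureJZeroSeamValuesGlue
import Literature.NumberTheory.ComplexMultiplication.EllipticUnits.GrossencharacterGaloisReadings
import Literature.NumberTheory.ComplexMultiplication.EllipticUnits.KatoUnitRepIndependence
import HarnessLib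

/-!
# The per-unit values of the `j = 0` seam AT ONE LEVEL of the lane, for EVERY label, at the fixed scale `Ω_E` ([I2] file 3b; proofs only)

Cell `bsd-print-cf2`, width seat `bsd-line-cf2-p1-w8` g14 (piece [I2] of the SEAM, file 3b); `--supports` the crux stmt-BirchSwinnertonDyer-20368
(helper, Theses-free).  THEOREMS ONLY; no `def`, no named fact, no `sorry`.

`forall_label_moment_eq_at_level` — the socket consumed by FILE-4 (`perUnitValues_of_lane`, [I2] v2): at one level `𝔪 = (μ) ≤ (v̄³)` of the
lane, with the global data of `…SeamValuesOfLabel` (frame at `v`, lane `ℤ₂`-datum, the level's coefficient field `E`, the readings `θ`, `ι_p`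
conjugate through `τ_K`, the model lattice `Λ_L = Ω_E·w₀(𝓞_K)`, the Grössencharacter clauses, the three `𝔓`-integrality ORACLES, the reference
division points with their Tate unit `a₀`), there are ONE ideal `𝔟` with `τ_K⁻¹|_{K(𝔣ψ𝔪v)} = (𝔟, ·)` and the class lattices `Λ_{LM} = Ω_E·w₀(𝔪)`,
`Λ_{Lat 𝔟₁} = Ω_E·w₀(𝔪/𝔟₁)` such that for EVERY label `𝔞 = (a)` prime to `𝔪v`, every unit `β ∈ 𝒰_E` reading `Θ(1; 𝔪v^{m+1}, 𝔞)` and every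
moment `k`: **`θ(c_{β,k}) = (θ(a₀)Φ((1−α₀)³))^{k+1}·ι_p⁻¹(−12(N𝔞·E_{k+1}(ψ(𝔟)Ω_E; LM) − E_{k+1}(ψ(𝔟)Ω_E; Lat 𝔞)))` and the Frobenius twin at
`α₀ψ(𝔟)Ω_E`**.  Proof: per label `forall_moment_eq_of_label` (values at scale `Ω_𝔪 = Ω_E/w₀ μ` and at the label ideal `𝔟′`); the base point is
moved from `ψ(𝔟′)Ω_𝔪` to `ψ(𝔟)Ω_𝔪` by the Galois readings of `ξ(Ω_𝔪)` (`algClosureEmb_smul_model_eq_of_absRestrictNormalHom_eq`,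
`sub_mem_lattice_of_model_readings_eq`, periodicity `eisensteinE_add_of_mem_lattice`), and the scale from `Ω_𝔪` to `Ω_E` by the homogeneity
`eisensteinE_eq_mul_eisensteinE_of_specs` (V1-glue), the factor `Φ(μ)^{k+1}` cancelling the level constant's denominator.
No summit statement is proved; BSD is not proved by any of this.

## References
* [deShalit1987] E. de Shalit, *Iwasawa theory of elliptic curves with complex multiplication* (1987), II §1.5 (15), II §2.3 (10), II §3.1 (5),
  II §4.10 (26), II §4.14 (38) (p. 71).
* [NeukirchANT1999] J. Neukirch, *Algebraic Number Theory* (1999), Ch. VI §7 (7.1).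
-/

-- the summit namespace `Summit.BirchSwinnertonDyer.BirchSwinnertonDyer` repeats the problem name by design (D-0017)
set_option linter.dupNamespace false
set_option autoImplicit false

noncomputable section

open scoped Classical
open scoped NumberField nonZeroDivisors
open PowerSeries IsDedekindDomain IsDedekindDomain.HeightOneSpectrum NumberField ValuativeRel Field PeriodPair
open Literature.NumberTheory.NumberFields Literature.NumberTheory.EllipticCurves Literature.NumberTheory.EllipticCurves.DeShalit1987
  Literature.NumberTheory.EllipticCurves.DivisionPointReadings Literature.NumberTheory.ComplexMultiplication.EllipticUnits
open Literature.NumberTheory.GaloisRepresentations Literature.NumberTheory.GaloisRepresentations.IsNonarchimedeanLocalField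
  Literature.NumberTheory.GaloisRepresentations.LubinTate Literature.NumberTheory.EllipticCurves.FormalGroupChart Literature.NumberTheory.PAdicHodge
  _root_.WeierstrassCurve
open Literature.NumberTheory.LFunctions.AbelianDensity (artinSymbol)
open Summit.BirchSwinnertonDyer.BirchSwinnertonDyer.Theorems.PrintCf2.KatzMeasureJZeroTop
  Summit.BirchSwinnertonDyer.BirchSwinnertonDyer.Theorems.PrintCf2.EllipticUnitsLocal

namespace Summit.BirchSwinnertonDyer.BirchSwinnertonDyer.Theorems.PrintCf2.KatzMeasureJZeroSeam

attribute [local instance] ltNormUniformSpace ltNormIsUniformAddGroup rk1 nF nE fintypeResidueField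

variable {K : Type} [Field K] [NumberField K]

set_option maxHeartbeats 6400000 in
/-- ★★★ **[I2] per level**: for every label `𝔞 = (a)` prime to `𝔪v` and every unit `β ∈ 𝒰_E` reading `Θ(1; 𝔪v^{m+1}, 𝔞)`, the moments of
`β` read through `θ` are `(θ(a₀)Φ((1−α₀)³))^{k+1}·ι_p⁻¹(−12(N𝔞·E_{k+1}(ψ(𝔟)Ω_E; Ω_E𝔪) − E_{k+1}(ψ(𝔟)Ω_E; Ω_E𝔪𝔞⁻¹)))` for ONE ideal `𝔟`
with `τ_K⁻¹|_{K(𝔣ψ𝔪v)} = (𝔟, ·)`. [cite: deShalit1987, II §4.10 (26), II §4.14 (38) (p. 71)] -/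
theorem forall_label_moment_eq_at_level
    -- the base field (imaginary quadratic), the split prime `v = (α₀) ∣ 2` of degree one, `v̄ = (1 − α₀)`
    [IsTotallyComplex K] (hK : IsImaginaryQuadratic K) (v : HeightOneSpectrum (𝓞 K)) [v.asIdeal.LiesOver (ratPlace 2).asIdeal]
    (he : v.asIdeal.ramificationIdx (𝓞 ℚ) = 1) (hf : v.asIdeal.inertiaDeg (𝓞 ℚ) = 1)
    {α₀ : 𝓞 K} (hv0 : v.asIdeal = Ideal.span {α₀}) (hα₀ : α₀ ^ 2 - α₀ + 2 = 0) (hprime₁ : Prime (1 - α₀))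
    (hq : residueFieldCard (v.adicCompletion K) = 2)
    (h2 : (valuation (v.adicCompletion K)).IsUniformizer ((((2 : ℕ) : 𝒪[v.adicCompletion K]) : v.adicCompletion K)))
    (u : 𝒪[v.adicCompletion K]ˣ)
    (hu : ((((u : 𝒪[v.adicCompletion K]) * ((2 : ℕ) : 𝒪[v.adicCompletion K]) : 𝒪[v.adicCompletion K]) : v.adicCompletion K)) =
      ((α₀ : K) : v.adicCompletion K))
    -- the lane's `ℤ₂`-datum of `W = [1,−1,0,−2,−1]`
    {c : ℤ_[2]} {P : PowerSeries ℤ_[2]}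
    (hPexp : P.map PadicInt.Coe.ringHom = ((⟨1, -1, 0, -2, -1⟩ : WeierstrassCurve ℤ_[2]).map PadicInt.Coe.ringHom).formalExp.subst
      (C (c : ℚ_[2]) * ((⟨1, -1, 0, -2, -1⟩ : WeierstrassCurve ℤ_[2]).map PadicInt.Coe.ringHom).formalLog))
    (hA : IsLTRing c 2) (hPlt : IsLTSeries c 2 P)
    (heπ : ((integerEquivAdicCompletionIntegers v).trans (padicIntEquivOfDegreeOne K 2 v he hf))
      ((u : 𝒪[v.adicCompletion K]) * ((2 : ℕ) : 𝒪[v.adicCompletion K])) = c)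
    (hc : padicEquivOfDegreeOne K 2 v he hf (algebraMap K (v.adicCompletion K) (α₀ : K)) = c)
    (hV : (((⟨1, -1, 0, -2, -1⟩ : WeierstrassCurve ℤ)).map (Int.castRingHom ℤ_[2])).formalGroupLaw = ltF hA hPlt)
    {ϖ : ℤ_[2]} (hp : ((2 : ℕ) : ℤ_[2]) = ϖ * c) (hϖ : IsUnit ϖ)
    -- the level's coefficient field `E` (finite Galois unramified) and a local Frobenius
    (E : IntermediateField (v.adicCompletion K) (AlgebraicClosure (v.adicCompletion K)))
    [FiniteDimensional (v.adicCompletion K) E] [IsGalois (v.adicCompletion K) E]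
    (hE : E ≤ maxUnramified (v.adicCompletion K)) {σ₀ : absoluteGaloisGroup (v.adicCompletion K)} (hσ₀ : IsAbsArithFrob σ₀)
    -- the two readings `θ`, `ι_p` conjugate through `τ_K` (Q-θ); `w₀ : K → ℂ`
    (θ : CompletedAlgClosure (v.adicCompletion K) →+* ℂ_[2]) (ιp : PadicAlgCl 2 ≃+* ℂ) (w₀ : InfinitePlace K) {τK : absoluteGaloisGroup K}
    (hτK : ∀ x : AlgebraicClosure K,
      θ (algClosureToC (v.adicCompletion K) (absClosureEmbedding K (v.adicCompletion K) (τK • x))) =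
        algebraMap (PadicAlgCl 2) ℂ_[2] (ιp.symm (algClosureEmb w₀.embedding x)))
    (hw : w₀.embedding (α₀ : K) ^ 2 = w₀.embedding (α₀ : K) - 2)
    -- the model lattice `Λ_L = Ω_E·w₀(𝓞_K)` of `W ⊗ ℂ`
    (L : PeriodPair) {ΩE : ℂ} (hLE : ∀ z : ℂ, z ∈ L.lattice ↔ ∃ a : 𝓞 K, z = ΩE * w₀.embedding (a : K)) (hΩE : ΩE ≠ 0)
    (h₂ : L.g₂ = (((⟨1, -1, 0, -2, -1⟩ : WeierstrassCurve ℤ)).baseChange ℂ).c₄ / 12)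
    (h₃ : L.g₃ = (((⟨1, -1, 0, -2, -1⟩ : WeierstrassCurve ℤ)).baseChange ℂ).c₆ / 216)
    -- the Grössencharacter: conductor `𝔣ψ` prime to `v`, clauses (ii)–(iv), `ψ(v) = α₀`, clauses (vi)/(vii) of II.1.5 (hypotheses)
    (ψK : Ideal (𝓞 K) → 𝓞 K) {𝔣ψ : Ideal (𝓞 K)} (h𝔣ψ0 : 𝔣ψ ≠ ⊥) (hv𝔣ψ : ¬ 𝔣ψ ≤ v.asIdeal)
    (hψmul : ∀ 𝔞 𝔟 : Ideal (𝓞 K), IsCoprime 𝔞 𝔣ψ → IsCoprime 𝔟 𝔣ψ → ψK (𝔞 * 𝔟) = ψK 𝔞 * ψK 𝔟)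
    (hψspan : ∀ 𝔞 : Ideal (𝓞 K), IsCoprime 𝔞 𝔣ψ → Ideal.span {ψK 𝔞} = 𝔞) (hψv : ψK v.asIdeal = α₀)
    (h6 : ∀ 𝔠 : Ideal (𝓞 K), 𝔠 ≠ ⊥ → ∀ z : ℂ, z ∈ idealInvLattice w₀.embedding 𝔠 L.lattice → z ∉ L.lattice →
      ∃ x y : rayClassField K (𝔣ψ * 𝔠), algClosureEmb w₀.embedding x = ℘[L] z ∧ algClosureEmb w₀.embedding y = ℘'[L] z)
    (h7 : ∀ 𝔠 : Ideal (𝓞 K), 𝔠 ≠ ⊥ → ∀ z : ℂ, z ∈ idealInvLattice w₀.embedding 𝔠 L.lattice → z ∉ L.lattice →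
      ∀ 𝔟 : Ideal (𝓞 K), IsCoprime 𝔟 (𝔣ψ * 𝔠) → ∀ x y : rayClassField K (𝔣ψ * 𝔠),
        algClosureEmb w₀.embedding x = ℘[L] z → algClosureEmb w₀.embedding y = ℘'[L] z →
          algClosureEmb w₀.embedding (artinSymbol (galFrob K (rayClassField K (𝔣ψ * 𝔠))) 𝔟 x) = ℘[L] (w₀.embedding (ψK 𝔟 : K) * z) ∧
          algClosureEmb w₀.embedding (artinSymbol (galFrob K (rayClassField K (𝔣ψ * 𝔠))) 𝔟 y) = ℘'[L] (w₀.embedding (ψK 𝔟 : K) * z))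
    -- the `𝔓`-INTEGRALITY ORACLES (de Shalit II.4.9 (i), pointwise; hypotheses): model coordinates of `𝔠`-division points (`v ∤ 𝔠`) lie
    -- in the reading ring, and the difference of the `x`-coordinates of two such points with `z₁ ± z₂ ∉ L` is a unit
    (hIx : ∀ (𝔠 : Ideal (𝓞 K)), 𝔠 ≠ ⊥ → ¬ 𝔠 ≤ v.asIdeal → ∀ z : ℂ, z ∈ idealInvLattice w₀.embedding 𝔠 L.lattice → z ∉ L.lattice →
      ∀ {𝔐 : Ideal (𝓞 K)} (F : IntermediateField (v.adicCompletion K) (AlgebraicClosure (v.adicCompletion K)))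
        [FiniteDimensional (v.adicCompletion K) F]
        (hF : ∀ y : AlgebraicClosure K, y ∈ rayClassField K 𝔐 → absClosureEmbedding K (v.adicCompletion K) y ∈ F) (X : rayClassField K 𝔐),
        algClosureEmb w₀.embedding X = ℘[L] z - (((⟨1, -1, 0, -2, -1⟩ : WeierstrassCurve ℤ)).baseChange ℂ).b₂ / 12 → X ∈ readingRing F hF)
    (hIy : ∀ (𝔠 : Ideal (𝓞 K)), 𝔠 ≠ ⊥ → ¬ 𝔠 ≤ v.asIdeal → ∀ z : ℂ, z ∈ idealInvLattice w₀.embedding 𝔠 L.lattice → z ∉ L.lattice →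
      ∀ {𝔐 : Ideal (𝓞 K)} (F : IntermediateField (v.adicCompletion K) (AlgebraicClosure (v.adicCompletion K)))
        [FiniteDimensional (v.adicCompletion K) F]
        (hF : ∀ y : AlgebraicClosure K, y ∈ rayClassField K 𝔐 → absClosureEmbedding K (v.adicCompletion K) y ∈ F) (Y : rayClassField K 𝔐),
        algClosureEmb w₀.embedding Y = (℘'[L] z - (((⟨1, -1, 0, -2, -1⟩ : WeierstrassCurve ℤ)).baseChange ℂ).a₁ *
          (℘[L] z - (((⟨1, -1, 0, -2, -1⟩ : WeierstrassCurve ℤ)).baseChange ℂ).b₂ / 12) - (((⟨1, -1, 0, -2, -1⟩ : WeierstrassCurve ℤ)).baseChange ℂ).a₃) / 2 →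
        Y ∈ readingRing F hF)
    (hIu : ∀ (𝔠 : Ideal (𝓞 K)), 𝔠 ≠ ⊥ → ¬ 𝔠 ≤ v.asIdeal → ∀ z₁ z₂ : ℂ, z₁ ∈ idealInvLattice w₀.embedding 𝔠 L.lattice →
      z₂ ∈ idealInvLattice w₀.embedding 𝔠 L.lattice → z₁ ∉ L.lattice → z₂ ∉ L.lattice → z₁ - z₂ ∉ L.lattice → z₁ + z₂ ∉ L.lattice →
      ∀ {𝔐 : Ideal (𝓞 K)} (F : IntermediateField (v.adicCompletion K) (AlgebraicClosure (v.adicCompletion K)))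
        [FiniteDimensional (v.adicCompletion K) F]
        (hF : ∀ y : AlgebraicClosure K, y ∈ rayClassField K 𝔐 → absClosureEmbedding K (v.adicCompletion K) y ∈ F) (X₁ X₂ : rayClassField K 𝔐),
        algClosureEmb w₀.embedding X₁ = ℘[L] z₁ - (((⟨1, -1, 0, -2, -1⟩ : WeierstrassCurve ℤ)).baseChange ℂ).b₂ / 12 →
        algClosureEmb w₀.embedding X₂ = ℘[L] z₂ - (((⟨1, -1, 0, -2, -1⟩ : WeierstrassCurve ℤ)).baseChange ℂ).b₂ / 12 →
        ‖(readingFieldHom F hF (X₁ - X₂) : F)‖ = 1)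
    -- the REFERENCE presentation `Λ_L = Ω_ref·w₀(v̄³)`, `Ω_ref = Ω_E/w₀((1−α₀)³)`, `β_r α₀ ≡ 1 (mod v̄³)`: its division points read in a finite
    -- Galois unramified `E₀`, with their Tate unit `a₀`
    (E₀ : IntermediateField (v.adicCompletion K) (AlgebraicClosure (v.adicCompletion K)))
    [FiniteDimensional (v.adicCompletion K) E₀] [IsGalois (v.adicCompletion K) E₀] (hE₀ : E₀ ≤ maxUnramified (v.adicCompletion K))
    {βr : 𝓞 K} (hβr : βr * α₀ - 1 ∈ Ideal.span {(1 - α₀) ^ 3})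
    [hEll₀ : ∀ m : ℕ, (curveOver (E₀ ⊔ ltField ((u : 𝒪[v.adicCompletion K]) * ((2 : ℕ) : 𝒪[v.adicCompletion K])) m :
        IntermediateField (v.adicCompletion K) (AlgebraicClosure (v.adicCompletion K)))
      ((((⟨1, -1, 0, -2, -1⟩ : WeierstrassCurve ℤ)).map (Int.castRingHom ℤ_[2])).map ((LTCoeff.of (v.adicCompletion K)).toRingHom.comp
        ((integerEquivAdicCompletionIntegers v).trans (padicIntEquivOfDegreeOne K 2 v he hf)).symm.toRingHom))).IsElliptic]
    (xu₀ yu₀ : ℕ → AlgebraicClosure K)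
    (XU₀ YU₀ : ∀ m : ℕ, ↥(E₀ ⊔ ltField ((u : 𝒪[v.adicCompletion K]) * ((2 : ℕ) : 𝒪[v.adicCompletion K])) m :
      IntermediateField (v.adicCompletion K) (AlgebraicClosure (v.adicCompletion K))))
    (hxu₀ : ∀ m : ℕ, algClosureEmb w₀.embedding (xu₀ m) =
      ℘[L] (w₀.embedding ((βr ^ (m + 1) : 𝓞 K) : K) * (ΩE / w₀.embedding (((1 - α₀) ^ 3 : 𝓞 K) : K)) -
        (ΩE / w₀.embedding (((1 - α₀) ^ 3 : 𝓞 K) : K)) / w₀.embedding ((α₀ ^ (m + 1) : 𝓞 K) : K)) -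
        (((⟨1, -1, 0, -2, -1⟩ : WeierstrassCurve ℤ)).baseChange ℂ).b₂ / 12)
    (hyu₀ : ∀ m : ℕ, algClosureEmb w₀.embedding (yu₀ m) =
      (℘'[L] (w₀.embedding ((βr ^ (m + 1) : 𝓞 K) : K) * (ΩE / w₀.embedding (((1 - α₀) ^ 3 : 𝓞 K) : K)) -
          (ΩE / w₀.embedding (((1 - α₀) ^ 3 : 𝓞 K) : K)) / w₀.embedding ((α₀ ^ (m + 1) : 𝓞 K) : K)) -
        (((⟨1, -1, 0, -2, -1⟩ : WeierstrassCurve ℤ)).baseChange ℂ).a₁ *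
          (℘[L] (w₀.embedding ((βr ^ (m + 1) : 𝓞 K) : K) * (ΩE / w₀.embedding (((1 - α₀) ^ 3 : 𝓞 K) : K)) -
            (ΩE / w₀.embedding (((1 - α₀) ^ 3 : 𝓞 K) : K)) / w₀.embedding ((α₀ ^ (m + 1) : 𝓞 K) : K)) -
            (((⟨1, -1, 0, -2, -1⟩ : WeierstrassCurve ℤ)).baseChange ℂ).b₂ / 12) - (((⟨1, -1, 0, -2, -1⟩ : WeierstrassCurve ℤ)).baseChange ℂ).a₃) / 2)
    (hXU₀ : ∀ m, ((XU₀ m : ↥(E₀ ⊔ ltField ((u : 𝒪[v.adicCompletion K]) * ((2 : ℕ) : 𝒪[v.adicCompletion K])) m :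
        IntermediateField (v.adicCompletion K) (AlgebraicClosure (v.adicCompletion K)))) : AlgebraicClosure (v.adicCompletion K)) =
      (absClosureEmbedding K (v.adicCompletion K)).toRingHom (xu₀ m))
    (hYU₀ : ∀ m, ((YU₀ m : ↥(E₀ ⊔ ltField ((u : 𝒪[v.adicCompletion K]) * ((2 : ℕ) : 𝒪[v.adicCompletion K])) m :
        IntermediateField (v.adicCompletion K) (AlgebraicClosure (v.adicCompletion K)))) : AlgebraicClosure (v.adicCompletion K)) =
      (absClosureEmbedding K (v.adicCompletion K)).toRingHom (yu₀ m))
    {a₀ : 𝒪[v.adicCompletion K]ˣ}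
    (ha₀ : ∀ (m : ℕ) (h : (curveOver (E₀ ⊔ ltField ((u : 𝒪[v.adicCompletion K]) * ((2 : ℕ) : 𝒪[v.adicCompletion K])) m :
          IntermediateField (v.adicCompletion K) (AlgebraicClosure (v.adicCompletion K)))
        ((((⟨1, -1, 0, -2, -1⟩ : WeierstrassCurve ℤ)).map (Int.castRingHom ℤ_[2])).map ((LTCoeff.of (v.adicCompletion K)).toRingHom.comp
          ((integerEquivAdicCompletionIntegers v).trans (padicIntEquivOfDegreeOne K 2 v he hf)).symm.toRingHom))).toAffine.Nonsingular
        (XU₀ m) (YU₀ m)),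
      ptOfZ (E₀ ⊔ ltField ((u : 𝒪[v.adicCompletion K]) * ((2 : ℕ) : 𝒪[v.adicCompletion K])) m :
          IntermediateField (v.adicCompletion K) (AlgebraicClosure (v.adicCompletion K)))
          ((((⟨1, -1, 0, -2, -1⟩ : WeierstrassCurve ℤ)).map (Int.castRingHom ℤ_[2])).map ((LTCoeff.of (v.adicCompletion K)).toRingHom.comp
            ((integerEquivAdicCompletionIntegers v).trans (padicIntEquivOfDegreeOne K 2 v he hf)).symm.toRingHom))
          (evalPt₁ (maxNilIdeal (v.adicCompletion K) (E₀ ⊔ ltField ((u : 𝒪[v.adicCompletion K]) * ((2 : ℕ) : 𝒪[v.adicCompletion K])) m :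
              IntermediateField (v.adicCompletion K) (AlgebraicClosure (v.adicCompletion K))))
            (hom (isLTRing_LTCoeff (isUniformizer_unit_mul h2 u))
              (isLTSeries_map_LTCoeff_of_degree_one ((integerEquivAdicCompletionIntegers v).trans (padicIntEquivOfDegreeOne K 2 v he hf))
                hq heπ hPlt) (isLTSeries_LTCoeff _) 1)
            (constantCoeff_hom _ _ _ 1)
            (evalPt₁ (maxNilIdeal (v.adicCompletion K) (E₀ ⊔ ltField ((u : 𝒪[v.adicCompletion K]) * ((2 : ℕ) : 𝒪[v.adicCompletion K])) m :
                IntermediateField (v.adicCompletion K) (AlgebraicClosure (v.adicCompletion K))))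
              (hom (isLTRing_LTCoeff (isUniformizer_unit_mul h2 u)) (isLTSeries_LTCoeff _) (isLTSeries_LTCoeff _)
                (LTCoeff.of (v.adicCompletion K) (a₀ : 𝒪[v.adicCompletion K])))
              (constantCoeff_hom _ _ _ _)
              (inclPt (le_sup_right : ltField ((u : 𝒪[v.adicCompletion K]) * ((2 : ℕ) : 𝒪[v.adicCompletion K])) m ≤
                  E₀ ⊔ ltField ((u : 𝒪[v.adicCompletion K]) * ((2 : ℕ) : 𝒪[v.adicCompletion K])) m)
                (cohPt (isUniformizer_unit_mul h2 u) m)))) =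
        (.some (XU₀ m) (YU₀ m) h : (curveOver (E₀ ⊔ ltField ((u : 𝒪[v.adicCompletion K]) * ((2 : ℕ) : 𝒪[v.adicCompletion K])) m :
            IntermediateField (v.adicCompletion K) (AlgebraicClosure (v.adicCompletion K)))
          ((((⟨1, -1, 0, -2, -1⟩ : WeierstrassCurve ℤ)).map (Int.castRingHom ℤ_[2])).map ((LTCoeff.of (v.adicCompletion K)).toRingHom.comp
            ((integerEquivAdicCompletionIntegers v).trans (padicIntEquivOfDegreeOne K 2 v he hf)).symm.toRingHom))).toAffine.Point))
    -- the LEVEL `𝔪 = (μ) ≤ (v̄³)` prime to `v`; the LABEL `𝔞 = (a)` prime to `𝔪v`, `L′ = 𝔞⁻¹L`, the unit `β`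
    {𝔪 : Ideal (𝓞 K)} {μ : 𝓞 K} (hμ0 : μ ≠ 0) (h𝔪μ : 𝔪 = Ideal.span {μ}) (h𝔪π : 𝔪 ≤ Ideal.span {(1 - α₀) ^ 3})
    (hv𝔪 : ¬ 𝔪 ≤ v.asIdeal)
    :
    ∃ (𝔟 : Ideal (𝓞 K)) (LM : PeriodPair) (Lat : Ideal (𝓞 K) → PeriodPair),
      IsCoprime 𝔟 (𝔣ψ * 𝔪 * v.asIdeal) ∧
      absRestrictNormalHom (rayClassField K (𝔣ψ * 𝔪 * v.asIdeal)) τK⁻¹ = artinSymbol (galFrob K (rayClassField K (𝔣ψ * 𝔪 * v.asIdeal))) 𝔟 ∧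
      (∀ z : ℂ, z ∈ LM.lattice ↔ ∃ y ∈ ((𝔪 : Ideal (𝓞 K)) : FractionalIdeal (𝓞 K)⁰ K), z = ΩE * w₀.embedding y) ∧
      (∀ 𝔟₁ : Ideal (𝓞 K), 𝔟₁ ≠ ⊥ → ∀ z : ℂ, z ∈ (Lat 𝔟₁).lattice ↔
        ∃ y ∈ ((𝔪 : FractionalIdeal (𝓞 K)⁰ K) / (𝔟₁ : FractionalIdeal (𝓞 K)⁰ K)), z = ΩE * w₀.embedding y) ∧
      ∀ {𝔞 : Ideal (𝓞 K)} {a : 𝓞 K} (_ : a ≠ 0) (_ : 𝔞 = Ideal.span {a}) (_ : IsCoprime 𝔞 (𝔪 * v.asIdeal))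
        (β : RelNormCoherentUnits (isUniformizer_unit_mul h2 u) E) (xg : ∀ m : ℕ, rayClassField K (𝔪 * v.asIdeal ^ (m + 1)))
        (_ : ∀ m, IsThetaValueOne w₀.embedding (𝔪 * v.asIdeal ^ (m + 1)) 𝔞
          (algClosureEmb w₀.embedding ((xg m : rayClassField K (𝔪 * v.asIdeal ^ (m + 1))) : AlgebraicClosure K)))
        (_ : ∀ m : ℕ, ((((β.val m : unitBall (E ⊔ ltField ((u : 𝒪[v.adicCompletion K]) * ((2 : ℕ) : 𝒪[v.adicCompletion K])) m :
            IntermediateField (v.adicCompletion K) (AlgebraicClosure (v.adicCompletion K)))) :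
            (E ⊔ ltField ((u : 𝒪[v.adicCompletion K]) * ((2 : ℕ) : 𝒪[v.adicCompletion K])) m :
              IntermediateField (v.adicCompletion K) (AlgebraicClosure (v.adicCompletion K)))) : AlgebraicClosure (v.adicCompletion K))) =
          (absClosureEmbedding K (v.adicCompletion K)).toRingHom ((xg m : rayClassField K (𝔪 * v.asIdeal ^ (m + 1))) : AlgebraicClosure K))
        (k : ℕ),
        (θ.comp ((CBall (v.adicCompletion K)).subtype.comp (unitBallToCBall E)))
            (PowerSeries.constantCoeff ((fun g : PowerSeries (unitBall E) =>
              (invDiff (isLTRing_LTCoeff (isUniformizer_unit_mul h2 u))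
                  (isLTSeries_LTCoeff ((u : 𝒪[v.adicCompletion K]) * ((2 : ℕ) : 𝒪[v.adicCompletion K])))).map
                  (algebraMap (LTCoeff (v.adicCompletion K)) (unitBall E)) *
                PowerSeries.derivative (unitBall E) g)^[k] (relLogDerivSeries (isUniformizer_unit_mul h2 u) E hq hE hσ₀ β))) =
          (θ (algebraMap (v.adicCompletion K) (CompletedAlgClosure (v.adicCompletion K)) ((a₀ : 𝒪[v.adicCompletion K]) : v.adicCompletion K)) *
              algebraMap (PadicAlgCl 2) ℂ_[2] (ιp.symm (w₀.embedding (((1 - α₀) ^ 3 : 𝓞 K) : K)))) ^ (k + 1) *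
            ((ιp.symm (-12 * (((Ideal.absNorm 𝔞 : ℕ) : ℂ) * LM.eisensteinE (k + 1) (w₀.embedding ((ψK 𝔟 : 𝓞 K) : K) * ΩE) -
              (Lat 𝔞).eisensteinE (k + 1) (w₀.embedding ((ψK 𝔟 : 𝓞 K) : K) * ΩE))) : PadicAlgCl 2) : ℂ_[2]) ∧
        (θ.comp ((CBall (v.adicCompletion K)).subtype.comp (unitBallToCBall E)))
            ((frobUnitBall E σ₀ : unitBall E →+* unitBall E) (PowerSeries.constantCoeff ((fun g : PowerSeries (unitBall E) =>
              (invDiff (isLTRing_LTCoeff (isUniformizer_unit_mul h2 u))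
                  (isLTSeries_LTCoeff ((u : 𝒪[v.adicCompletion K]) * ((2 : ℕ) : 𝒪[v.adicCompletion K])))).map
                  (algebraMap (LTCoeff (v.adicCompletion K)) (unitBall E)) *
                PowerSeries.derivative (unitBall E) g)^[k] (relLogDerivSeries (isUniformizer_unit_mul h2 u) E hq hE hσ₀ β)))) =
          (θ (algebraMap (v.adicCompletion K) (CompletedAlgClosure (v.adicCompletion K)) ((a₀ : 𝒪[v.adicCompletion K]) : v.adicCompletion K)) *
              algebraMap (PadicAlgCl 2) ℂ_[2] (ιp.symm (w₀.embedding (((1 - α₀) ^ 3 : 𝓞 K) : K)))) ^ (k + 1) *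
            ((ιp.symm (-12 * (((Ideal.absNorm 𝔞 : ℕ) : ℂ) *
                LM.eisensteinE (k + 1) (w₀.embedding ((α₀ : 𝓞 K) : K) * (w₀.embedding ((ψK 𝔟 : 𝓞 K) : K) * ΩE)) -
              (Lat 𝔞).eisensteinE (k + 1) (w₀.embedding ((α₀ : 𝓞 K) : K) * (w₀.embedding ((ψK 𝔟 : 𝓞 K) : K) * ΩE)))) : PadicAlgCl 2) : ℂ_[2]) := by
  -- ### the frame at `v` and the level modulus
  have hprime : Prime α₀ := prime_of_generator hv0
  have h2K : (2 : 𝓞 K) = α₀ * (1 - α₀) := two_eq_generator_mul_one_sub hα₀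
  have htr : α₀ + (1 - α₀) = 1 := generator_add_one_sub α₀
  have hcopv : ∀ I : Ideal (𝓞 K), ¬ I ≤ v.asIdeal → IsCoprime v.asIdeal I := fun I hI ↦ by
    rw [Ideal.isCoprime_iff_sup_eq]
    by_contra hne
    exact hI ((v.isMaximal.eq_of_le hne le_sup_left).symm ▸ le_sup_right)
  have hμ𝔪 : μ ∈ 𝔪 := h𝔪μ ▸ Ideal.mem_span_singleton_self μ
  have h𝔪0 : 𝔪 ≠ ⊥ := by rw [h𝔪μ]; simpa [Ideal.span_singleton_eq_bot] using hμ0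
  have h𝔪1 : 𝔪 ≠ ⊤ := ne_top_of_le_span_pow hprime₁ (n := 3) (by norm_num) h𝔪π
  have h𝔣𝔪0 : 𝔣ψ * 𝔪 ≠ ⊥ := mul_ne_zero h𝔣ψ0 h𝔪0
  have hv𝔣𝔪 : ¬ 𝔣ψ * 𝔪 ≤ v.asIdeal := fun h ↦ (v.isPrime.mul_le.mp h).elim hv𝔣ψ hv𝔪
  have h𝔣𝔪v0 : 𝔣ψ * 𝔪 * v.asIdeal ≠ ⊥ := mul_ne_zero h𝔣𝔪0 v.ne_bot
  have hvψ : IsCoprime v.asIdeal 𝔣ψ := hcopv _ hv𝔣ψ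
  -- ### the scale `Ω_𝔪 = Ω_E / w₀ μ` and the presentation `Λ_L = Ω_𝔪·w₀(𝔪)`
  set Ω' : ℂ := ΩE / w₀.embedding (μ : K) with hΩ'def
  have hΩ' : Ω' ≠ 0 := modelLattice_scale_ne_zero w₀.embedding hΩE hμ0
  have hL' : ∀ z : ℂ, z ∈ L.lattice ↔ ∃ t ∈ 𝔪, z = Ω' * w₀.embedding (t : K) :=
    modelLattice_spec_of_span_singleton_eq w₀.embedding hLE hμ0 h𝔪μ
  have hΛ : IsCMLattice w₀.embedding L.lattice := isCMLattice_of_model w₀.embedding hL'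
  have hΩ'L : Ω' ∉ L.lattice := notMem_lattice_of_model w₀.embedding hL' hΩ' h𝔪1
  have hΩ'𝔪 : Ω' ∈ idealInvLattice w₀.embedding 𝔪 L.lattice := mem_idealInvLattice_of_model w₀.embedding hL'
  have hwμ : w₀.embedding (μ : K) ≠ 0 := (map_ne_zero _).mpr (by exact_mod_cast hμ0)
  have hΩEμ : ΩE = w₀.embedding (μ : K) * Ω' := by rw [hΩ'def]; field_simp
  -- ### the LEVEL ideal `𝔟`: `τ_K⁻¹|_{K(𝔣ψ𝔪v)} = (𝔟, ·)`, restricted to `K(𝔣ψ𝔪)`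
  obtain ⟨𝔟, h𝔟0, h𝔟cop, h𝔟art⟩ := exists_ideal_artinSymbol_eq_absRestrictNormalHom h𝔣𝔪v0 τK⁻¹
  have h𝔟c : IsCoprime 𝔟 (𝔣ψ * 𝔪) := h𝔟cop.of_mul_right_left
  have h𝔟ψ : IsCoprime 𝔟 𝔣ψ := h𝔟c.of_mul_right_left
  have h𝔟𝔪 : IsCoprime 𝔟 𝔪 := h𝔟c.of_mul_right_right
  obtain ⟨g𝔟, hg𝔟⟩ := exists_forall_absRestrictNormalHom_eq_artinSymbol_of_isCoprime h𝔟0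
  have hg : absRestrictNormalHom (rayClassField K (𝔣ψ * 𝔪)) τK⁻¹ = artinSymbol (galFrob K (rayClassField K (𝔣ψ * 𝔪))) 𝔟 := by
    rw [← hg𝔟 _ h𝔣𝔪0 h𝔟c]
    exact absRestrictNormalHom_eq_of_le (σ := τK⁻¹) (τ := g𝔟) (rayClassField_le_of_le h𝔣𝔪v0 Ideal.mul_le_right)
      (by rw [← h𝔟art, hg𝔟 _ h𝔣𝔪v0 h𝔟cop])
  have hψ𝔟 : Ideal.span {ψK 𝔟} = 𝔟 := hψspan 𝔟 h𝔟ψ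
  -- `ψ(𝔟)Ω_𝔪 ∉ L`
  have hψ𝔟L : w₀.embedding (ψK 𝔟 : K) * Ω' ∉ L.lattice := by
    intro h
    rw [mul_comm, mul_mem_lattice_iff_of_model w₀.embedding hL' hΩ'] at h
    have hle : 𝔟 ≤ 𝔪 := by rw [← hψ𝔟]; exact (Ideal.span_singleton_le_iff_mem _).mpr h
    have htop := Ideal.isCoprime_iff_sup_eq.mp h𝔟𝔪
    rw [sup_eq_right.mpr hle] at htop
    exact h𝔪1 htop
  -- ### the class lattices at scale `Ω_E`
  obtain ⟨Lat, hLat⟩ := exists_classLattices hK w₀.embedding h𝔪0 hΩE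
  have hLM : ∀ z : ℂ, z ∈ (Lat ⊤).lattice ↔ ∃ y ∈ ((𝔪 : Ideal (𝓞 K)) : FractionalIdeal (𝓞 K)⁰ K), z = ΩE * w₀.embedding y := by
    intro z
    rw [hLat ⊤ (by simp), FractionalIdeal.coeIdeal_top, div_one]
  -- ### the model coordinates of `ξ(Ω_𝔪)` at `K(𝔣ψ𝔪)` and their Galois reading by `τ_K⁻¹`
  obtain ⟨x0, y0, hx0, hy0⟩ := h6 𝔪 h𝔪0 Ω' hΩ'𝔪 hΩ'L
  obtain ⟨hX₀, hY₀⟩ := algClosureEmb_modelCoords w₀.embedding (rayClassField K (𝔣ψ * 𝔪)) hx0 hy0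
  have hread𝔟 := algClosureEmb_smul_model_eq_of_absRestrictNormalHom_eq w₀.embedding (⟨1, -1, 0, -2, -1⟩ : WeierstrassCurve ℤ)
    (fun z hz hzL x y hx hy ↦ h7 𝔪 h𝔪0 z hz hzL 𝔟 h𝔟c x y hx hy) hg hΩ'𝔪 hΩ'L (SetLike.coe_mem _) (SetLike.coe_mem _) hX₀ hY₀
  refine ⟨𝔟, Lat ⊤, Lat, h𝔟cop, h𝔟art.symm, hLM, hLat, ?_⟩
  intro 𝔞 a ha0 h𝔞a h𝔞cop β xg hxg hβv k
  -- ### per label: FILE-3a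
  have h𝔞0 : 𝔞 ≠ ⊥ := by rw [h𝔞a]; simpa [Ideal.span_singleton_eq_bot] using ha0
  have h𝔞𝔪 : IsCoprime 𝔞 𝔪 := h𝔞cop.of_mul_right_left
  obtain ⟨La, hLa⟩ := exists_periodPair_lattice_eq_idealInvLattice hΛ h𝔞0
  obtain ⟨𝔟', h𝔟'0, h𝔟'cop, h𝔟'art, hval⟩ := forall_moment_eq_of_label hK v he hf hv0 hα₀ hprime₁ hq h2 u hu hPexp hA hPlt heπ hc hV hp hϖ
    E hE hσ₀ θ ιp w₀ hτK hw L hLE hΩE h₂ h₃ ψK h𝔣ψ0 hv𝔣ψ hψmul hψspan hψv h6 h7 hIx hIy hIu E₀ hE₀ hβr xu₀ yu₀ XU₀ YU₀ hxu₀ hyu₀ hXU₀ hYU₀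
    ha₀ hμ0 h𝔪μ h𝔪π hv𝔪 ha0 h𝔞a h𝔞cop La hLa β xg hxg hβv
  obtain ⟨hv1, hv2⟩ := hval k
  -- ### moving the base point from `ψ(𝔟′)Ω_𝔪` to `ψ(𝔟)Ω_𝔪`
  have h𝔞𝔪0 : 𝔣ψ * (𝔪 * 𝔞) ≠ ⊥ := mul_ne_zero h𝔣ψ0 (mul_ne_zero h𝔪0 h𝔞0)
  have h𝔟'c : IsCoprime 𝔟' (𝔣ψ * 𝔪) := (h𝔟'cop.of_mul_right_left).of_mul_right_left.mul_right
    ((h𝔟'cop.of_mul_right_left).of_mul_right_right.of_mul_right_left)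
  have h𝔟'ψ : IsCoprime 𝔟' 𝔣ψ := h𝔟'c.of_mul_right_left
  have h𝔟'𝔪 : IsCoprime 𝔟' 𝔪 := h𝔟'c.of_mul_right_right
  obtain ⟨g𝔟', hg𝔟'⟩ := exists_forall_absRestrictNormalHom_eq_artinSymbol_of_isCoprime h𝔟'0
  have hg' : absRestrictNormalHom (rayClassField K (𝔣ψ * 𝔪)) τK⁻¹ = artinSymbol (galFrob K (rayClassField K (𝔣ψ * 𝔪))) 𝔟' := by
    rw [← hg𝔟' _ h𝔣𝔪0 h𝔟'c]
    exact absRestrictNormalHom_eq_of_le (σ := τK⁻¹) (τ := g𝔟')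
      (rayClassField_le_of_le (mul_ne_zero h𝔞𝔪0 v.ne_bot) ((Ideal.mul_le_right).trans (Ideal.mul_mono_right Ideal.mul_le_right)))
      (by rw [h𝔟'art, hg𝔟' _ (mul_ne_zero h𝔞𝔪0 v.ne_bot) h𝔟'cop])
  have hψ𝔟' : Ideal.span {ψK 𝔟'} = 𝔟' := hψspan 𝔟' h𝔟'ψ
  have hψ𝔟'L : w₀.embedding (ψK 𝔟' : K) * Ω' ∉ L.lattice := by
    intro h
    rw [mul_comm, mul_mem_lattice_iff_of_model w₀.embedding hL' hΩ'] at h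
    have hle : 𝔟' ≤ 𝔪 := by rw [← hψ𝔟']; exact (Ideal.span_singleton_le_iff_mem _).mpr h
    have htop := Ideal.isCoprime_iff_sup_eq.mp h𝔟'𝔪
    rw [sup_eq_right.mpr hle] at htop
    exact h𝔪1 htop
  have hread𝔟' := algClosureEmb_smul_model_eq_of_absRestrictNormalHom_eq w₀.embedding (⟨1, -1, 0, -2, -1⟩ : WeierstrassCurve ℤ)
    (fun z hz hzL x y hx hy ↦ h7 𝔪 h𝔪0 z hz hzL 𝔟' h𝔟'c x y hx hy) hg' hΩ'𝔪 hΩ'L (SetLike.coe_mem _) (SetLike.coe_mem _) hX₀ hY₀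
  have hsub : w₀.embedding (ψK 𝔟' : K) * Ω' - w₀.embedding (ψK 𝔟 : K) * Ω' ∈ L.lattice :=
    sub_mem_lattice_of_model_readings_eq hψ𝔟'L hψ𝔟L (hread𝔟'.1.symm.trans hread𝔟.1) (hread𝔟'.2.symm.trans hread𝔟.2)
  have hψv𝔟' : ψK (𝔟' * v.asIdeal) = ψK 𝔟' * α₀ := by rw [hψmul 𝔟' v.asIdeal h𝔟'ψ hvψ, hψv]
  have hmove : ∀ {L' : PeriodPair}, L.lattice ≤ L'.lattice → ∀ n : ℕ,
      L'.eisensteinE n (w₀.embedding (ψK 𝔟' : K) * Ω') = L'.eisensteinE n (w₀.embedding (ψK 𝔟 : K) * Ω') ∧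
      L'.eisensteinE n (w₀.embedding (ψK (𝔟' * v.asIdeal) : K) * Ω') = L'.eisensteinE n (w₀.embedding (α₀ : K) * (w₀.embedding (ψK 𝔟 : K) * Ω')) := by
    intro L' hLL' n
    constructor
    · rw [show w₀.embedding (ψK 𝔟' : K) * Ω' = w₀.embedding (ψK 𝔟 : K) * Ω' + (w₀.embedding (ψK 𝔟' : K) * Ω' - w₀.embedding (ψK 𝔟 : K) * Ω') by ring,
        L'.eisensteinE_add_of_mem_lattice n (hLL' hsub)]
    · have h1 : w₀.embedding (α₀ : K) * (w₀.embedding (ψK 𝔟' : K) * Ω' - w₀.embedding (ψK 𝔟 : K) * Ω') ∈ L.lattice := hΛ α₀ _ hsub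
      rw [show w₀.embedding (ψK (𝔟' * v.asIdeal) : K) * Ω' = w₀.embedding (α₀ : K) * (w₀.embedding (ψK 𝔟 : K) * Ω') +
          w₀.embedding (α₀ : K) * (w₀.embedding (ψK 𝔟' : K) * Ω' - w₀.embedding (ψK 𝔟 : K) * Ω') by rw [hψv𝔟']; push_cast; rw [map_mul]; ring,
        L'.eisensteinE_add_of_mem_lattice n (hLL' h1)]
  obtain ⟨hmL1, hmL2⟩ := hmove (L' := L) le_rfl (k + 1)
  obtain ⟨hmLa1, hmLa2⟩ := hmove (L' := La) (hLa ▸ le_idealInvLattice hΛ 𝔞) (k + 1)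
  -- ### rescaling `Ω_𝔪 → Ω_E`
  have hspecL : ∀ z : ℂ, z ∈ L.lattice ↔ ∃ x ∈ ((𝔪 : Ideal (𝓞 K)) : FractionalIdeal (𝓞 K)⁰ K), z = Ω' * w₀.embedding x :=
    latticeSpec_coeIdeal w₀.embedding hL'
  have hspecLa : ∀ z : ℂ, z ∈ La.lattice ↔ ∃ x ∈ ((𝔪 : FractionalIdeal (𝓞 K)⁰ K) / (𝔞 : FractionalIdeal (𝓞 K)⁰ K)), z = Ω' * w₀.embedding x :=
    latticeSpec_div_of_idealInvLattice w₀.embedding h𝔞0 hΩ' hL' hLa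
  have hsc1 : ∀ z : ℂ, L.eisensteinE (k + 1) z = w₀.embedding (μ : K) ^ (k + 1) * (Lat ⊤).eisensteinE (k + 1) (w₀.embedding (μ : K) * z) :=
    eisensteinE_eq_mul_eisensteinE_of_specs w₀.embedding _ hwμ hΩEμ hspecL hLM (k + 1)
  have hsc2 : ∀ z : ℂ, La.eisensteinE (k + 1) z = w₀.embedding (μ : K) ^ (k + 1) * (Lat 𝔞).eisensteinE (k + 1) (w₀.embedding (μ : K) * z) :=
    eisensteinE_eq_mul_eisensteinE_of_specs w₀.embedding _ hwμ hΩEμ hspecLa (hLat 𝔞 h𝔞0) (k + 1)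
  have hz1 : w₀.embedding (μ : K) * (w₀.embedding (ψK 𝔟 : K) * Ω') = w₀.embedding ((ψK 𝔟 : 𝓞 K) : K) * ΩE := by rw [hΩEμ]; ring
  have hz2 : w₀.embedding (μ : K) * (w₀.embedding (α₀ : K) * (w₀.embedding (ψK 𝔟 : K) * Ω')) =
      w₀.embedding ((α₀ : 𝓞 K) : K) * (w₀.embedding ((ψK 𝔟 : 𝓞 K) : K) * ΩE) := by rw [hΩEμ]; ring
  -- ### the constant and the assembly
  have hΦμ : algebraMap (PadicAlgCl 2) ℂ_[2] (ιp.symm (w₀.embedding (μ : K))) ≠ 0 := by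
    rw [map_ne_zero_iff _ (algebraMap (PadicAlgCl 2) ℂ_[2]).injective, map_ne_zero_iff _ ιp.symm.injective]; exact hwμ
  have key : ∀ X Y : ℂ,
      (θ (algebraMap (v.adicCompletion K) (CompletedAlgClosure (v.adicCompletion K)) ((a₀ : 𝒪[v.adicCompletion K]) : v.adicCompletion K)) *
            algebraMap (PadicAlgCl 2) ℂ_[2] (ιp.symm (w₀.embedding (((1 - α₀) ^ 3 : 𝓞 K) : K))) /
            algebraMap (PadicAlgCl 2) ℂ_[2] (ιp.symm (w₀.embedding (μ : K)))) ^ (k + 1) *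
          ((ιp.symm (-12 * (((Ideal.absNorm 𝔞 : ℕ) : ℂ) * (w₀.embedding (μ : K) ^ (k + 1) * X) - w₀.embedding (μ : K) ^ (k + 1) * Y)) :
            PadicAlgCl 2) : ℂ_[2]) =
        (θ (algebraMap (v.adicCompletion K) (CompletedAlgClosure (v.adicCompletion K)) ((a₀ : 𝒪[v.adicCompletion K]) : v.adicCompletion K)) *
            algebraMap (PadicAlgCl 2) ℂ_[2] (ιp.symm (w₀.embedding (((1 - α₀) ^ 3 : 𝓞 K) : K)))) ^ (k + 1) *
          ((ιp.symm (-12 * (((Ideal.absNorm 𝔞 : ℕ) : ℂ) * X - Y)) : PadicAlgCl 2) : ℂ_[2]) := by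
    intro X Y
    have e1 : -12 * (((Ideal.absNorm 𝔞 : ℕ) : ℂ) * (w₀.embedding (μ : K) ^ (k + 1) * X) - w₀.embedding (μ : K) ^ (k + 1) * Y) =
        w₀.embedding (μ : K) ^ (k + 1) * (-12 * (((Ideal.absNorm 𝔞 : ℕ) : ℂ) * X - Y)) := by ring
    rw [e1, map_mul, map_pow]
    change _ * (algebraMap (PadicAlgCl 2) ℂ_[2] (ιp.symm (w₀.embedding (μ : K)) ^ (k + 1) * ιp.symm (-12 * (((Ideal.absNorm 𝔞 : ℕ) : ℂ) * X - Y)))) =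
      _ * algebraMap (PadicAlgCl 2) ℂ_[2] (ιp.symm (-12 * (((Ideal.absNorm 𝔞 : ℕ) : ℂ) * X - Y)))
    rw [map_mul, map_pow, div_pow, mul_pow]
    field_simp
  refine ⟨?_, ?_⟩
  · rw [hv1, hmL1, hmLa1, hsc1, hsc2, hz1, key]
  · rw [hv2, hmL2, hmLa2, hsc1, hsc2, hz2, key]


end Summit.BirchSwinnertonDyer.BirchSwinnertonDyer.Theorems.PrintCf2.KatzMeasureJZeroSeam

end
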